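import Mathlib
import HarnessLib
import Summits.ValiantsHypothesis.ValiantsHypothesis.Theses.MonotoneRestoration
import Literature.Computability.AlgebraicComplexity.ArithCircuit
import Literature.Computability.AlgebraicComplexity.ArithCircuitProofs
import Literature.Computability.AlgebraicComplexity.MonotoneStructure
import Literature.Computability.AlgebraicComplexity.PermanentIrreducible
import Literature.ModelTheory.FiniteModelTheory.CkEquiv
import Summits.ValiantsHypothesis.ValiantsHypothesis.Theorems.MonotoneRestorationMonotoneRestorationQPCosetCount
import Summits.ValiantsHypothesis.ValiantsHypothesis.Theorems.MonotoneRestorationMonotoneRestorationQPSymmetricLB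
import Summits.ValiantsHypothesis.ValiantsHypothesis.Theorems.MonotoneRestorationMonotoneRestorationQPSupportSymmetrisation
import Summits.ValiantsHypothesis.ValiantsHypothesis.Theorems.MonotoneRestorationMonotoneRestorationQPSparseRegime
import Summits.ValiantsHypothesis.ValiantsHypothesis.Theorems.MonotoneRestorationMonotoneRestorationQPBeta
import Literature.Computability.AlgebraicComplexity.SymmetricArithCircuit
import Literature.Computability.AlgebraicComplexity.DawarWilsenach2025Proofs
import Literature.GroupTheory.PermutationGroups.SmallIndexSubgroups
import Summits.ValiantsHypothesis.ValiantsHypothesis.Theorems.MonotoneRestorationQP.Negative.LoadBearing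
import Summits.ValiantsHypothesis.ValiantsHypothesis.Theorems.MonotoneRestorationMonotoneRestorationQPPermSupportCount

/-! TTRL-lite variant V20729 of stmt-ValiantsHypothesis-15886 -/

-- `Summit.ValiantsHypothesis.ValiantsHypothesis.…` is the tree's mandated single-conjunct layout
-- (Sub = Summit), so the duplicated namespace component is intended.
set_option linter.dupNamespace false

namespace Summit.ValiantsHypothesis.ValiantsHypothesis.Theorems

open Summit.ValiantsHypothesis.ValiantsHypothesis.Theses.MonotoneRestoration
open Literature.Computability.AlgebraicComplexity

/-- TTRL-lite variant V20729 of `stmt-ValiantsHypothesis-15886` (lower bound on any valid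
threshold): if `4 * ((log₂ n + c)^c + 2) ≤ n` holds for all `n ≥ N`, then `N > (2c)^c`.
Proof: at `n = (2c)^c` one has `log₂ n ≥ c`, hence `(log₂ n + c)^c ≥ (2c)^c = n > n/4`. -/
theorem stub_gammaArithmetic_var20729 :
    ∀ (c N : ℕ), (∀ n : ℕ, N ≤ n → 4 * ((Nat.log 2 n + c) ^ c + 2) ≤ n) → (2 * c) ^ c < N := by
  intro c N h
  by_contra hN
  push Not at hN
  have h1 := h ((2 * c) ^ c) hN
  have h2 : c ≤ Nat.log 2 ((2 * c) ^ c) := by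
    rcases Nat.eq_zero_or_pos c with rfl | hc
    · exact Nat.zero_le _
    · have h2c : 2 ^ c ≤ (2 * c) ^ c := Nat.pow_le_pow_left (by omega) c
      exact Nat.le_log_of_pow_le (by norm_num) h2c
  have h3 : (2 * c) ^ c ≤ (Nat.log 2 ((2 * c) ^ c) + c) ^ c :=
    Nat.pow_le_pow_left (by omega) c
  omega

end Summit.ValiantsHypothesis.ValiantsHypothesis.Theorems
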